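import Summits.Ventures.Crystal3D.Bulk.GapKiteCalculus
import Summits.Ventures.Crystal3D.Bulk.GapKiteCurve
import HarnessLib

/-!
# Peak rows of the P-kite by a BOX around the peak: a kite row whose quadratic is `≥ 0` before a
# window `[s₁, s₂]` and `≤ 0` after it is bounded by the corner-wise box value on the window —
# plus uniform literal tests for the curve at a fixed parameter

HONEST FRAMING. Part of the venture `Summits/Ventures/Crystal3D` (cell `pub-crystal3d`, phase 2;
seat p2, PROMOTION-AUDIT prep, memo r1.1 A6 (b1): the B-lineage hole-quadrilateral tables `PZ4_I`
/ `PZ4_W1`). Kernel theorems about an ADMISSIBLE fourteen-ball configuration `c` (`IsGapConfig c`;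
no extremality, NO convexity / face hypothesis) and pure real lemmas; nothing here asserts
anything about GAP(1.26); no census number, head, class or grade word moves.

For a P-kite `(p, a, b, e)` with corners `u₁ = corner c a 13 b`, `u₂ = corner c 13 a e`,
`u₄ = corner c b a e` on the curve `(u_a, u_p, u_b)(x)`, `x = ⟪u_b, p̂⟫ ∈ [x♭(D), D/2]`
(`Bulk/GapKiteCurve.lean`), and a row `α u₁ + c₂ u₂ + c₄ u₄` whose quadratic `q_D` changes sign
from `+` to `−` INSIDE the family (the row peaks at a `D`-dependent parameter):

* §1 uniform literal tests at a fixed parameter `s`: `kiteUa_le_of` (`u_a(D, s) ≤ U` from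
  `cos U ≤ c` and `c·√3·√(4 − D²) ≤ 4s − D`, the latter from a squared comparison,
  `kite_cS_le_of_nonpos` / `kite_cS_le_of_nonneg`), `kite_arccos_div_le_of` /
  `kite_le_arccos_div_of` (`arccos (N/M) ≤ U`, `L ≤ arccos (N/M)` from `c M ≤ N` / `N ≤ c M`);
* §2 each corner is monotone along the family: `kiteUa_anti` (`u_a` decreasing in `x`),
  `kiteUp_mono`, `kiteUb_mono` (increasing) — instances of `kiteRow_*_of_quad_*`;
* §3 **`IsGapConfig.kite_row_le_box`**: if `q_D ≥ 0` on `[x♭(D), s₁]`, `q_D ≤ 0` on `[s₂, D/2]`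
  and on the window `α u_a ≤ T_A`, `c₂ u_p ≤ T_P`, `c₄ u_b ≤ T_B`, then
  `α u₁ + c₂ u₂ + c₄ u₄ ≤ T_A + T_P + T_B`; and its certified form on a `D`-cell
  **`IsGapConfig.kite_row_le_box_of_cert`** (four Lukács certificates for the signs of `q`, the
  window bounds supplied per sign of the coefficient at ONE window end by corner monotonicity).
-/

noncomputable section

open scoped BigOperators InnerProductSpace
open Finset Real Set

namespace Summit.Ventures.Crystal3D

/-! ## §1 Uniform literal tests for the curve at a fixed parameter -/

/-- `u_a(D, s) ≤ U` from `cos U ≤ c` and `c · (√3 √(4 − D²)) ≤ 4s − D`. [folklore] -/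
theorem kiteUa_le_of {D s U c : ℝ} (hD : D ^ 2 < 4) (hU0 : 0 ≤ U) (hUπ : U ≤ π)
    (hc : Real.cos U ≤ c) (h : c * (√3 * √(4 - D ^ 2)) ≤ 4 * s - D) :
    Real.arccos ((4 * s - D) / (√3 * √(4 - D ^ 2))) ≤ U := by
  have hS : 0 < √3 * √(4 - D ^ 2) :=
    mul_pos (Real.sqrt_pos.2 (by norm_num)) (Real.sqrt_pos.2 (by linarith))
  have hw : Real.cos U ≤ (4 * s - D) / (√3 * √(4 - D ^ 2)) :=
    hc.trans (by rw [le_div_iff₀ hS]; exact h)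
  calc Real.arccos ((4 * s - D) / (√3 * √(4 - D ^ 2)))
      ≤ Real.arccos (Real.cos U) := Real.arccos_le_arccos hw
    _ = U := Real.arccos_cos hU0 hUπ

/-- Feeder, case `c ≤ 0`: `(D − 4s)² ≤ 3c²(4 − D²)` gives `c · (√3 √(4 − D²)) ≤ 4s − D`. -/
theorem kite_cS_le_of_nonpos {D s c : ℝ} (hD : D ^ 2 < 4) (hc : c ≤ 0)
    (h : (D - 4 * s) ^ 2 ≤ 3 * c ^ 2 * (4 - D ^ 2)) :
    c * (√3 * √(4 - D ^ 2)) ≤ 4 * s - D := by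
  have hS2 : (√3 * √(4 - D ^ 2)) ^ 2 = 3 * (4 - D ^ 2) := by
    rw [mul_pow, Real.sq_sqrt (by norm_num : (0:ℝ) ≤ 3), Real.sq_sqrt (by linarith)]
  have hS0 : 0 ≤ √3 * √(4 - D ^ 2) := by positivity
  have h2 : (D - 4 * s) ^ 2 ≤ ((-c) * (√3 * √(4 - D ^ 2))) ^ 2 := by
    rw [mul_pow, hS2]; nlinarith [h]
  have h3 := (abs_le_of_sq_le_sq' h2 (mul_nonneg (by linarith) hS0)).2
  linarith

/-- Feeder, case `0 ≤ 4s − D` (used for `c ≥ 0`): `3c²(4 − D²) ≤ (4s − D)²` gives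
`c · (√3 √(4 − D²)) ≤ 4s − D`. -/
theorem kite_cS_le_of_nonneg {D s c : ℝ} (hD : D ^ 2 < 4) (hs : 0 ≤ 4 * s - D)
    (h : 3 * c ^ 2 * (4 - D ^ 2) ≤ (4 * s - D) ^ 2) :
    c * (√3 * √(4 - D ^ 2)) ≤ 4 * s - D := by
  have hS2 : (√3 * √(4 - D ^ 2)) ^ 2 = 3 * (4 - D ^ 2) := by
    rw [mul_pow, Real.sq_sqrt (by norm_num : (0:ℝ) ≤ 3), Real.sq_sqrt (by linarith)]
  have h2 : (c * (√3 * √(4 - D ^ 2))) ^ 2 ≤ (4 * s - D) ^ 2 := by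
    rw [mul_pow, hS2]; nlinarith [h]
  exact (abs_le_of_sq_le_sq' h2 hs).2

/-- `arccos (N/M) ≤ U` from `0 < M`, `cos U ≤ c` and `c M ≤ N`. [folklore] -/
theorem kite_arccos_div_le_of {N M U c : ℝ} (hM : 0 < M) (hU0 : 0 ≤ U) (hUπ : U ≤ π)
    (hc : Real.cos U ≤ c) (h : c * M ≤ N) : Real.arccos (N / M) ≤ U := by
  have hw : Real.cos U ≤ N / M := hc.trans (by rw [le_div_iff₀ hM]; exact h)
  calc Real.arccos (N / M) ≤ Real.arccos (Real.cos U) := Real.arccos_le_arccos hw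
    _ = U := Real.arccos_cos hU0 hUπ

/-- `L ≤ arccos (N/M)` from `0 < M`, `c ≤ cos L` and `N ≤ c M`. [folklore] -/
theorem kite_le_arccos_div_of {N M L c : ℝ} (hM : 0 < M) (hL0 : 0 ≤ L) (hLπ : L ≤ π)
    (hc : c ≤ Real.cos L) (h : N ≤ c * M) : L ≤ Real.arccos (N / M) := by
  have hw : N / M ≤ Real.cos L := (by rw [div_le_iff₀ hM]; exact h : N / M ≤ c).trans hc
  calc L = Real.arccos (Real.cos L) := (Real.arccos_cos hL0 hLπ).symm
    _ ≤ Real.arccos (N / M) := Real.arccos_le_arccos hw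

/-- The flat end below a rational: `(D − 3s)² ≤ 6 − 2D²` gives `x♭(D) ≤ s`. -/
theorem kite_flat_le_of_sq {D s : ℝ} (h : (D - 3 * s) ^ 2 ≤ 6 - 2 * D ^ 2) :
    (D - √(6 - 2 * D ^ 2)) / 3 ≤ s := by
  have h1 : D - 3 * s ≤ √(6 - 2 * D ^ 2) := (le_abs_self _).trans (Real.abs_le_sqrt h)
  linarith

/-! ## §2 Each corner is monotone along the family -/

/-- `u_a` is decreasing in `x` (`0 < D`, `D² < 2`, `x₁ ≤ x₂ ≤ D/2`, `Q(x₁) > 0`). -/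
theorem kiteUa_anti {D x₁ x₂ : ℝ} (hD0 : 0 < D) (hD2 : D ^ 2 < 2) (h12 : x₁ ≤ x₂)
    (hx₂ : x₂ ≤ D / 2) (hQ : 0 < 3 - D ^ 2 + 2 * D * x₁ - 4 * x₁ ^ 2) :
    Real.arccos ((4 * x₂ - D) / (√3 * √(4 - D ^ 2))) ≤
      Real.arccos ((4 * x₁ - D) / (√3 * √(4 - D ^ 2))) := by
  have h := kiteRow_ge_of_quad_nonpos (α := 1) (c₂ := 0) (c₄ := 0) hD0 hD2 h12 hx₂ hQ
    (fun y hy => by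
      have hQy := kiteQ_pos_of_le (by linarith) hQ hy.1 (hy.2.trans hx₂)
      have hDy : D * y ≤ D * (D / 2) := mul_le_mul_of_nonneg_left (hy.2.trans hx₂) hD0.le
      nlinarith)
  linarith

/-- `u_p` is increasing in `x`. -/
theorem kiteUp_mono {D x₁ x₂ : ℝ} (hD0 : 0 < D) (hD2 : D ^ 2 < 2) (h12 : x₁ ≤ x₂)
    (hx₂ : x₂ ≤ D / 2) (hQ : 0 < 3 - D ^ 2 + 2 * D * x₁ - 4 * x₁ ^ 2) :
    Real.arccos (((4 + D ^ 2) * x₁ ^ 2 - 4 * D * x₁ + D ^ 2 - 2) / ((4 - D ^ 2) * (1 - x₁ ^ 2))) ≤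
      Real.arccos (((4 + D ^ 2) * x₂ ^ 2 - 4 * D * x₂ + D ^ 2 - 2) /
        ((4 - D ^ 2) * (1 - x₂ ^ 2))) := by
  have h := kiteRow_le_of_quad_nonneg (α := 0) (c₂ := 1) (c₄ := 0) hD0 hD2 h12 hx₂ hQ
    (fun y hy => by have : y ≤ D / 2 := hy.2.trans hx₂; nlinarith)
  linarith

/-- `u_b` is increasing in `x`. -/
theorem kiteUb_mono {D x₁ x₂ : ℝ} (hD0 : 0 < D) (hD2 : D ^ 2 < 2) (h12 : x₁ ≤ x₂)
    (hx₂ : x₂ ≤ D / 2) (hQ : 0 < 3 - D ^ 2 + 2 * D * x₁ - 4 * x₁ ^ 2) :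
    Real.arccos ((5 * x₁ ^ 2 - 4 * D * x₁ + 2 * D ^ 2 - 3) / (3 * (1 - x₁ ^ 2))) ≤
      Real.arccos ((5 * x₂ ^ 2 - 4 * D * x₂ + 2 * D ^ 2 - 3) / (3 * (1 - x₂ ^ 2))) := by
  have h := kiteRow_le_of_quad_nonneg (α := 0) (c₂ := 0) (c₄ := 1) hD0 hD2 h12 hx₂ hQ
    (fun y hy => by
      have hDy : D * y ≤ D * (D / 2) := mul_le_mul_of_nonneg_left (hy.2.trans hx₂) hD0.le
      nlinarith)
  linarith

/-! ## §3 Peak rows by a box around the peak -/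

section Config

open Literature.Geometry.DiscreteGeometry InnerProductGeometry

variable {c : Fin 14 → EuclideanSpace ℝ (Fin 3)}

/-- **Box around the peak.** For an admissible configuration with `D² < 2`, a P-kite `(p, a, b, e)`,
reals `α, c₂, c₄` and a window `x♭(D) ≤ s₁ ≤ s₂ ≤ D/2` such that the kite quadratic is `≥ 0` on
`[x♭(D), s₁]` and `≤ 0` on `[s₂, D/2]`, and window bounds `α u_a ≤ T_A`, `c₂ u_p ≤ T_P`,
`c₄ u_b ≤ T_B` on `[s₁, s₂]`: `α u₁ + c₂ u₂ + c₄ u₄ ≤ T_A + T_P + T_B`. [folklore] -/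
theorem IsGapConfig.kite_row_le_box (hc : IsGapConfig c) (hD2 : intruderDist c ^ 2 < 2)
    {a e b : Fin 14} (ha0 : a ≠ 0) (ha13 : a ≠ 13) (he0 : e ≠ 0) (he13 : e ≠ 13) (hb0 : b ≠ 0)
    (hb13 : b ≠ 13) (hae : a ≠ e) (ha : dist (c a) (c 13) = 1) (he : dist (c e) (c 13) = 1)
    (hba : dist (c b) (c a) = 1) (hbe : dist (c b) (c e) = 1) (α c₂ c₄ s₁ s₂ TA TP TB : ℝ)
    (hs : s₁ ≤ s₂) (hs1 : (intruderDist c - √(6 - 2 * intruderDist c ^ 2)) / 3 ≤ s₁)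
    (hs2 : s₂ ≤ intruderDist c / 2)
    (hq1 : ∀ y ∈ Icc ((intruderDist c - √(6 - 2 * intruderDist c ^ 2)) / 3) s₁,
      0 ≤ α * y ^ 2 - (c₂ + c₄ * intruderDist c) * y + (c₂ * intruderDist c + c₄ - α))
    (hq2 : ∀ y ∈ Icc s₂ (intruderDist c / 2),
      α * y ^ 2 - (c₂ + c₄ * intruderDist c) * y + (c₂ * intruderDist c + c₄ - α) ≤ 0)
    (hA : ∀ y ∈ Icc s₁ s₂,
      α * Real.arccos ((4 * y - intruderDist c) / (√3 * √(4 - intruderDist c ^ 2))) ≤ TA)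
    (hP : ∀ y ∈ Icc s₁ s₂, c₂ * Real.arccos (((4 + intruderDist c ^ 2) * y ^ 2 -
      4 * intruderDist c * y + intruderDist c ^ 2 - 2) /
        ((4 - intruderDist c ^ 2) * (1 - y ^ 2))) ≤ TP)
    (hB : ∀ y ∈ Icc s₁ s₂, c₄ * Real.arccos ((5 * y ^ 2 - 4 * intruderDist c * y +
      2 * intruderDist c ^ 2 - 3) / (3 * (1 - y ^ 2))) ≤ TB) :
    α * corner c a 13 b + c₂ * corner c 13 a e + c₄ * corner c b a e ≤ TA + TP + TB := by
  have hD1 : 1 ≤ intruderDist c := hc.one_le_intruderDist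
  have hD0 : 0 < intruderDist c := by linarith
  obtain ⟨hx, hP0, h1, h2, h3⟩ :=
    hc.kite_on_curve hD2.le ha0 ha13 he0 he13 hb0 hb13 hae ha he hba hbe
  have hQ := kiteQ_pos_of_flat_nonpos hD0.le hx hP0
  have hfl := kite_flat_le (D := intruderDist c) (by linarith) hP0
  rw [h1, h2, h3]
  rcases le_or_gt ⟪gapDir c b, gapDir c 13⟫_ℝ s₁ with hx1 | hx1
  · -- before the window: increasing up to `s₁`
    have hm := kiteRow_le_of_quad_nonneg (α := α) (c₂ := c₂) (c₄ := c₄) hD0 hD2 hx1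
      (hs.trans hs2) hQ (fun y hy => hq1 y ⟨hfl.trans hy.1, hy.2⟩)
    have h1' := hA s₁ (left_mem_Icc.2 hs)
    have h2' := hP s₁ (left_mem_Icc.2 hs)
    have h3' := hB s₁ (left_mem_Icc.2 hs)
    linarith
  rcases le_or_gt ⟪gapDir c b, gapDir c 13⟫_ℝ s₂ with hx2 | hx2
  · -- inside the window
    have hmem : ⟪gapDir c b, gapDir c 13⟫_ℝ ∈ Icc s₁ s₂ := ⟨hx1.le, hx2⟩
    have h1' := hA _ hmem
    have h2' := hP _ hmem
    have h3' := hB _ hmem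
    linarith
  · -- after the window: decreasing from `s₂`
    obtain ⟨hroot, -⟩ := kite_flat_root (D := intruderDist c) (by linarith)
    have hfh := kite_flat_le_half (D := intruderDist c) hD0.le
    have hQf := kiteQ_pos_of_flat_nonpos hD0.le hfh hroot.le
    have hQs := kiteQ_pos_of_le (by linarith) hQf (hs1.trans hs) hs2
    have hm := kiteRow_ge_of_quad_nonpos (α := α) (c₂ := c₂) (c₄ := c₄) hD0 hD2 hx2.le hx hQs
      (fun y hy => hq2 y ⟨hy.1, hy.2.trans hx⟩)
    have h1' := hA s₂ (right_mem_Icc.2 hs)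
    have h2' := hP s₂ (right_mem_Icc.2 hs)
    have h3' := hB s₂ (right_mem_Icc.2 hs)
    linarith

/-- Window bound for the `u_a` term from ONE end by monotonicity: `α ≥ 0` and `u_a(s₁) ≤ A`, or
`α ≤ 0` and `A ≤ u_a(s₂)`, give `α u_a ≤ α A` on `[s₁, s₂]`. -/
theorem kite_window_ua {D α s₁ s₂ A : ℝ} (hD0 : 0 < D) (hD2 : D ^ 2 < 2)
    (hs1 : (D - √(6 - 2 * D ^ 2)) / 3 ≤ s₁) (hs2 : s₂ ≤ D / 2)
    (h : (0 ≤ α ∧ Real.arccos ((4 * s₁ - D) / (√3 * √(4 - D ^ 2))) ≤ A) ∨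
      (α ≤ 0 ∧ A ≤ Real.arccos ((4 * s₂ - D) / (√3 * √(4 - D ^ 2))))) :
    ∀ y ∈ Icc s₁ s₂, α * Real.arccos ((4 * y - D) / (√3 * √(4 - D ^ 2))) ≤ α * A := by
  intro y hy
  obtain ⟨hroot, -⟩ := kite_flat_root (D := D) (by linarith)
  have hQf := kiteQ_pos_of_flat_nonpos hD0.le (kite_flat_le_half hD0.le) hroot.le
  have hQ1 := kiteQ_pos_of_le (by linarith) hQf hs1 ((hy.1.trans hy.2).trans hs2)
  have hQy := kiteQ_pos_of_le (by linarith) hQ1 hy.1 (hy.2.trans hs2)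
  rcases h with ⟨hα, hA⟩ | ⟨hα, hA⟩
  · exact mul_le_mul_of_nonneg_left ((kiteUa_anti hD0 hD2 hy.1 (hy.2.trans hs2) hQ1).trans hA) hα
  · exact mul_le_mul_of_nonpos_left (hA.trans (kiteUa_anti hD0 hD2 hy.2 hs2 hQy)) hα

/-- Window bound for the `u_p` term: `c₂ ≥ 0` and `u_p(s₂) ≤ P`, or `c₂ ≤ 0` and `P ≤ u_p(s₁)`. -/
theorem kite_window_up {D c₂ s₁ s₂ P : ℝ} (hD0 : 0 < D) (hD2 : D ^ 2 < 2)
    (hs1 : (D - √(6 - 2 * D ^ 2)) / 3 ≤ s₁) (hs2 : s₂ ≤ D / 2)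
    (h : (0 ≤ c₂ ∧ Real.arccos (((4 + D ^ 2) * s₂ ^ 2 - 4 * D * s₂ + D ^ 2 - 2) /
        ((4 - D ^ 2) * (1 - s₂ ^ 2))) ≤ P) ∨
      (c₂ ≤ 0 ∧ P ≤ Real.arccos (((4 + D ^ 2) * s₁ ^ 2 - 4 * D * s₁ + D ^ 2 - 2) /
        ((4 - D ^ 2) * (1 - s₁ ^ 2))))) :
    ∀ y ∈ Icc s₁ s₂, c₂ * Real.arccos (((4 + D ^ 2) * y ^ 2 - 4 * D * y + D ^ 2 - 2) /
      ((4 - D ^ 2) * (1 - y ^ 2))) ≤ c₂ * P := by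
  intro y hy
  obtain ⟨hroot, -⟩ := kite_flat_root (D := D) (by linarith)
  have hQf := kiteQ_pos_of_flat_nonpos hD0.le (kite_flat_le_half hD0.le) hroot.le
  have hQ1 := kiteQ_pos_of_le (by linarith) hQf hs1 ((hy.1.trans hy.2).trans hs2)
  have hQy := kiteQ_pos_of_le (by linarith) hQ1 hy.1 (hy.2.trans hs2)
  rcases h with ⟨hc, hP⟩ | ⟨hc, hP⟩
  · exact mul_le_mul_of_nonneg_left ((kiteUp_mono hD0 hD2 hy.2 hs2 hQy).trans hP) hc
  · exact mul_le_mul_of_nonpos_left (hP.trans (kiteUp_mono hD0 hD2 hy.1 (hy.2.trans hs2) hQ1)) hc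

/-- Window bound for the `u_b` term: `c₄ ≥ 0` and `u_b(s₂) ≤ B`, or `c₄ ≤ 0` and `B ≤ u_b(s₁)`. -/
theorem kite_window_ub {D c₄ s₁ s₂ B : ℝ} (hD0 : 0 < D) (hD2 : D ^ 2 < 2)
    (hs1 : (D - √(6 - 2 * D ^ 2)) / 3 ≤ s₁) (hs2 : s₂ ≤ D / 2)
    (h : (0 ≤ c₄ ∧ Real.arccos ((5 * s₂ ^ 2 - 4 * D * s₂ + 2 * D ^ 2 - 3) / (3 * (1 - s₂ ^ 2))) ≤ B) ∨
      (c₄ ≤ 0 ∧ B ≤ Real.arccos ((5 * s₁ ^ 2 - 4 * D * s₁ + 2 * D ^ 2 - 3) / (3 * (1 - s₁ ^ 2))))) :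
    ∀ y ∈ Icc s₁ s₂,
      c₄ * Real.arccos ((5 * y ^ 2 - 4 * D * y + 2 * D ^ 2 - 3) / (3 * (1 - y ^ 2))) ≤ c₄ * B := by
  intro y hy
  obtain ⟨hroot, -⟩ := kite_flat_root (D := D) (by linarith)
  have hQf := kiteQ_pos_of_flat_nonpos hD0.le (kite_flat_le_half hD0.le) hroot.le
  have hQ1 := kiteQ_pos_of_le (by linarith) hQf hs1 ((hy.1.trans hy.2).trans hs2)
  have hQy := kiteQ_pos_of_le (by linarith) hQ1 hy.1 (hy.2.trans hs2)
  rcases h with ⟨hc, hB⟩ | ⟨hc, hB⟩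
  · exact mul_le_mul_of_nonneg_left ((kiteUb_mono hD0 hD2 hy.2 hs2 hQy).trans hB) hc
  · exact mul_le_mul_of_nonpos_left (hB.trans (kiteUb_mono hD0 hD2 hy.1 (hy.2.trans hs2) hQ1)) hc

end Config

end Summit.Ventures.Crystal3D

end
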